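import Summits.BirchSwinnertonDyer.BirchSwinnertonDyer.Theses.PAdicOrderV2
import Literature.NumberTheory.EllipticCurves.SelmerCorankControl

/-!
# Crux `PAdicOrderComparisonR2` (stmt-BirchSwinnertonDyer-0489), line `Sketch` — stub SS-bridge:
# integral `T`-semisimplicity implies `ker (T ⊗ 1)² = ker (T ⊗ 1)` on `ℚ_p ⊗_{ℤ_p} X`

Registered stub `stub_ker_mulTRat_sq_eq` of the skeleton `Cruxes/PAdicOrderComparisonR2/Lines/Sketch.lean`
(v5). Pure commutative algebra over `Λ = ℤ_p⟦T⟧`: for a `Λ`-module `X`, the INTEGRAL spelling of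
`T`-semisimplicity used by the route item `PAdicOrderSemisimpleR3` — "if `p^k T² x = 0` for some `k`
then `p^{k'} T x = 0` for some `k'`" — implies the RATIONAL one used by the tree fact
`Greenberg1999_order_charGenerator_eq_coinvariantsRank` — `ker A² = ker A` for `A = T ⊗ 1` on
`V = ℚ_p ⊗_{ℤ_p} X` (`IwasawaAlgebra.mulTRat`). Proof: `x ↦ 1 ⊗ x` is a localisation of `ℤ_p`-modules
at `ℤ_p ∖ {0}` (`IsLocalization.tensorProduct_isLocalizedModule`), so every `v ∈ V` has `s • v = 1 ⊗ x`
with `s ≠ 0`, and `1 ⊗ y = 0` iff `t • y = 0` for some `t ≠ 0`, i.e. (`t = u p^k`, `u` a unit) iff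
`p^k y = 0` for some `k`; and non-zero constants act invertibly on the `ℚ_p`-space `V`.
Greenberg, LNM 1716, §1, Conj. 1.12 and the paragraph after it (p. 65).
-/

set_option linter.dupNamespace false

namespace Summit.BirchSwinnertonDyer.BirchSwinnertonDyer.Theorems

open scoped TensorProduct
open Literature.NumberTheory.EllipticCurves

/-- **Stub SS-bridge of line `Sketch` (crux #2 `PAdicOrderComparisonR2`).** For a `Λ`-module `X`
(`Λ = ℤ_p⟦T⟧`): if every `x ∈ X` with `p^k T² x = 0` for some `k` satisfies `p^{k'} T x = 0` for some
`k'`, then `ker (T ⊗ 1)² = ker (T ⊗ 1)` on `ℚ_p ⊗_{ℤ_p} X`. [cite: GreenbergLNM1716, §1 Conj. 1.12 (p. 65)] -/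
theorem stub_ker_mulTRat_sq_eq :
    ∀ (p : ℕ) [Fact p.Prime] (X : Type) [AddCommGroup X]
      [Module (Literature.NumberTheory.EllipticCurves.IwasawaAlgebra p) X],
      (∀ x : X,
        (∃ k : ℕ, (PowerSeries.C ((p : ℤ_[p]) ^ k) * PowerSeries.X ^ 2 :
            Literature.NumberTheory.EllipticCurves.IwasawaAlgebra p) • x = 0) →
          ∃ k : ℕ, (PowerSeries.C ((p : ℤ_[p]) ^ k) * PowerSeries.X :
            Literature.NumberTheory.EllipticCurves.IwasawaAlgebra p) • x = 0) →
      LinearMap.ker (Literature.NumberTheory.EllipticCurves.IwasawaAlgebra.mulTRat p X ∘ₗ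
          Literature.NumberTheory.EllipticCurves.IwasawaAlgebra.mulTRat p X) =
        LinearMap.ker (Literature.NumberTheory.EllipticCurves.IwasawaAlgebra.mulTRat p X) := by
  intro p _ X _ _ hss
  -- notation: `M` = `X` as a `ℤ_p`-module, `V = ℚ_p ⊗ M`, `ι x = 1 ⊗ x`, `A = T ⊗ 1`
  let M := RestrictScalars ℤ_[p] (IwasawaAlgebra p) X
  let ι : M →ₗ[ℤ_[p]] ℚ_[p] ⊗[ℤ_[p]] M := TensorProduct.mk ℤ_[p] ℚ_[p] M 1
  let A := IwasawaAlgebra.mulTRat p X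
  haveI : IsLocalizedModule (nonZeroDivisors ℤ_[p]) ι :=
    IsLocalization.tensorProduct_isLocalizedModule (nonZeroDivisors ℤ_[p]) ℚ_[p]
  -- `A (1 ⊗ x) = 1 ⊗ (T • x)`
  have hAι : ∀ x : X, A (ι (show M from x)) =
      ι (show M from ((PowerSeries.X : IwasawaAlgebra p) • x)) := fun x =>
    IwasawaAlgebra.mulTRat_tmul p X 1 x
  -- the `ℤ_p`-action on `M` is the action of constants
  have hCsmul : ∀ (c : ℤ_[p]) (x : X), (c • (show M from x) : M) =
      (show M from ((PowerSeries.C c : IwasawaAlgebra p) • x)) := fun c x => by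
    change (algebraMap ℤ_[p] (IwasawaAlgebra p) c) • x = _
    rw [PowerSeries.algebraMap_eq]
  -- non-zero constants act injectively on the `ℚ_p`-vector space `V`
  have hinj : ∀ (c : ℤ_[p]) (w : ℚ_[p] ⊗[ℤ_[p]] M), c ≠ 0 → c • w = 0 → w = 0 := by
    intro c w hc hw
    rw [← algebraMap_smul ℚ_[p] c w] at hw
    exact (smul_eq_zero.mp hw).resolve_left
      (fun h => hc (IsFractionRing.injective ℤ_[p] ℚ_[p] (by rw [h, map_zero])))
  -- `1 ⊗ y = 0` iff `p^k • y = 0` for some `k`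
  have hι0 : ∀ y : X, ι (show M from y) = 0 →
      ∃ k : ℕ, (PowerSeries.C ((p : ℤ_[p]) ^ k) : IwasawaAlgebra p) • y = 0 := by
    intro y hy
    obtain ⟨t, ht⟩ := (IsLocalizedModule.eq_zero_iff (nonZeroDivisors ℤ_[p]) ι).mp hy
    have ht0 : (t : ℤ_[p]) ≠ 0 := nonZeroDivisors.coe_ne_zero t
    refine ⟨(t : ℤ_[p]).valuation, ?_⟩
    have hu := PadicInt.unitCoeff_spec ht0
    -- `t • y = C t • y = C u • C (p^k) • y = 0`, and `C u` is a unit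
    have h1 : ((PowerSeries.C (t : ℤ_[p]) : IwasawaAlgebra p)) • y = 0 := by
      have := ht
      rw [Submonoid.smul_def] at this
      rwa [hCsmul] at this
    rw [hu, map_mul, mul_smul] at h1
    have hunit : IsUnit (PowerSeries.C ((PadicInt.unitCoeff ht0 : ℤ_[p]ˣ) : ℤ_[p]) :
        IwasawaAlgebra p) := (PadicInt.unitCoeff ht0).isUnit.map PowerSeries.C
    obtain ⟨v, hv⟩ := hunit
    have h2 := congrArg (fun z => ((v⁻¹ : (IwasawaAlgebra p)ˣ) : IwasawaAlgebra p) • z) h1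
    simp only [smul_zero] at h2
    rwa [← hv, smul_smul, Units.inv_mul, one_smul] at h2
  -- `p^k • (1 ⊗ y) = 1 ⊗ (C (p^k) • y)`
  have hιC : ∀ (k : ℕ) (y : X), ((p : ℤ_[p]) ^ k) • ι (show M from y) =
      ι (show M from ((PowerSeries.C ((p : ℤ_[p]) ^ k) : IwasawaAlgebra p) • y)) := by
    intro k y
    rw [← map_smul, hCsmul]
  refine le_antisymm ?_ ?_
  · intro v hv
    rw [LinearMap.mem_ker, LinearMap.comp_apply] at hv
    rw [LinearMap.mem_ker]
    -- `s • v = 1 ⊗ x` with `s ≠ 0`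
    obtain ⟨⟨xM, s⟩, hx⟩ := IsLocalizedModule.surj (nonZeroDivisors ℤ_[p]) ι v
    simp only at hx
    let x : X := xM
    have hxM : xM = (show M from x) := rfl
    rw [hxM] at hx
    have hs0 : (s : ℤ_[p]) ≠ 0 := nonZeroDivisors.coe_ne_zero s
    -- `1 ⊗ (T² x) = A (A (s • v)) = s • A (A v) = 0`
    have hT2 : ι (show M from ((PowerSeries.X : IwasawaAlgebra p) •
        (PowerSeries.X : IwasawaAlgebra p) • x)) = 0 := by
      rw [← hAι, ← hAι]
      change A (A (ι (show M from x))) = 0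
      rw [← hx, Submonoid.smul_def, LinearMap.map_smul_of_tower, LinearMap.map_smul_of_tower, hv,
        smul_zero]
    obtain ⟨k, hk⟩ := hι0 _ hT2
    -- integral semisimplicity: `p^{k'} T x = 0`
    obtain ⟨k', hk'⟩ := hss x ⟨k, by rw [mul_smul, pow_two, mul_smul]; exact hk⟩
    -- hence `p^{k'} • (s • A v) = 1 ⊗ (p^{k'} T x) = 0`, so `A v = 0`
    have h3 : ((p : ℤ_[p]) ^ k') • ((s : ℤ_[p]) • A v) = 0 := by
      have : (s : ℤ_[p]) • A v = ι (show M from ((PowerSeries.X : IwasawaAlgebra p) • x)) := by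
        rw [← hAι, ← hx, Submonoid.smul_def, LinearMap.map_smul_of_tower]
      rw [this, hιC, ← mul_smul, hk']
      exact map_zero ι
    have hpk : ((p : ℤ_[p]) ^ k') ≠ 0 := pow_ne_zero _ (by exact_mod_cast (Fact.out : p.Prime).ne_zero)
    exact hinj _ _ hs0 (hinj _ _ hpk h3)
  · intro v hv
    rw [LinearMap.mem_ker] at hv
    rw [LinearMap.mem_ker, LinearMap.comp_apply, hv, map_zero]

end Summit.BirchSwinnertonDyer.BirchSwinnertonDyer.Theorems
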